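import Literature.MathematicalPhysics.QuantumFieldTheory.Balaban1983to89.LatticeFieldCalculus
import Literature.MathematicalPhysics.QuantumFieldTheory.Balaban1983to89.B1Eq17Urep

/-!
# `Balaban1983to89.B3Eq28SummationByParts` — T. Bałaban, *(Higgs)₂,₃ quantum fields in a finite volume. III. Renormalization*,
Commun. Math. Phys. **88** (1983) 411–445 [Balaban1983Higgs3]: the integration-by-parts identity (2.8) p. 425 at the vertex (2.4),
PROVED on the concrete lattice calculus of `…Balaban1983to89.LatticeFieldCalculus` (v1.1: + the lattice Taylor formula (3.10) p. 435 along the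
straight and the staircase contours of the same calculus)

statement-level skeleton of published theorems with citation tags; proofs where landed; nothing here is a claim about the Yang–Mills mass gap

PDF held: `paper:balaban1983-higgs-2-3-quantum-fields-finite-volume` (journal page = PDF page + 410).  Read on the ×2 renders
`run/shared/lean/pub/pub-balaban/b2b-balaban-ref1/pages/1983-cmp88-higgs23-III/1983-cmp88-higgs23-III-p015-x2.png` (p. 425, (2.8)), `…-p025`
(p. 435, (3.10)), `…-p003` (p. 413, the vertex (1.8)); conventions: B1 = [Balaban1982Higgs1] p. 605 ((1.7) `(D^ε_Aφ)(b) = ε⁻¹(U(A_b)φ(b₊) − φ(b₋))`,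
"antisymmetry of `q` implies `U(A)* = U(−A) = U(−A)⁻¹`"), B4 = [Balaban1983RegularityDecay] p. 572 (`A_{⟨x,x+ηe_μ⟩} = A_μ(x)`); never the OCR layer.

CITATION HEADER (lean-in-tree rule).  Part of the lit-balaban TYPED SKELETON (HOME `run/shared/lean/pub/lit-balaban/`), PHASE 2,
seat p20 (PHASE2-TARGETS.md §G.3), row **B3.Eq2.8-2.9** of `HOME/lit-balaban-r15/ROWS-B3.md` (nominated by reader r15, note P3).
WHAT IS REPRODUCED.  The display **(2.8)** p. 425 ("integration by parts" at a vertex of the graph (2.4); quoted verbatim at `eq28`) as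
kernel-checked identities: (i) its first equality = `D^{η*}_B̃` IS THE `ℓ²`-ADJOINT OF `D^η_B̃` (`sum_inner_covDerivScalar`, `eq28_adjoint`);
(ii) its second equality = the LEIBNIZ RULE for `D^{η*}_B̃` on the bond function `b ↦ φ′(b₋)g(b₋)A′_b` (`covDivScalar_leibniz`); (iii) the
whole chain (`eq28_two` for two scalar legs `φ′`, `ψ′` — the two `φ′`-legs of the vertex are distinct legs of the graph — and its literal
one-field specialization `eq28`).

WHICH CARRIER (PHASE2-TARGETS §G.3: "state which carrier in the header").  The tori `Site P j` / bonds `PBond P j` of `…Balaban1983to89.Setup`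
with the linear/covariant lattice calculus of `…Balaban1983to89.LatticeFieldCalculus` (p239006): the forward covariant derivative
`covDerivScalar c Urep A φ` ((D_Aφ)(b) = c·(U(A_b)φ(b₊) − φ(b₋)), B1 (1.7)), the divergence `diverg c` (= ∂^{η*}), the backward difference
`pdiffAdj c μ` (= ∂^{η*}_μ, (∂*_μ g)(x) = c·(g(x − e_μ) − g(x))), lattice factor `c = η⁻¹` and weight `w = η^d` as bookkeeping reals,
`U = Urep : ℝ → (W →ₗ[ℝ] W)` a representation on a real inner-product space `W` (= ℝ^N, `U(A) = exp(qηeA)` in print; §7), `q : W →ₗ[ℝ] W`.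
T_η is a torus: no boundary terms.  The two printed facts used are the HYPOTHESES `hU : ⟪U(a)v, v′⟫ = ⟪v, U(−a)v′⟫` (B1 p. 605
"U(A)* = U(−A)") and `hq : q ∘ U(a) = U(a) ∘ q`.  NEW OBJECTS (definitions with bodies, the printed operators of (2.8)): `covDerivScalarAdj` =
the backward covariant derivative `(D^{η*}_{A,μ}ψ)(x) = c·(U(−A_{⟨x−e_μ,x⟩})ψ(x − e_μ) − ψ(x))`, `covDivScalar` = the covariant divergence
`(D^{η*}_A F)(x) = Σ_μ c·(U(−A_{⟨x−e_μ,x⟩})F(⟨x−e_μ,x⟩) − F(⟨x,x+e_μ⟩))` of a `W`-valued bond function (B1 p. 605: `−Δ_A = D*_A D_A`).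

TRANSCRIPT NOTE T-p20-1 (print observation, recorded in `HOME/GAPS.md`; the typed reading is stated, not silently substituted).  In
the LAST term of (2.8) the page prints `(D^η_{B̃,μ}φ′)(x)` WITHOUT the adjoint star.  The identity that holds — and the one the
paper's own second expression `φ′(x)·q(D^{η*}_B̃ φ′gA′)(x)` expands to by the Leibniz rule (ii) — carries the BACKWARD covariant
derivative `(D^{η*}_{B̃,μ}φ′)(x) = η⁻¹(U(B̃_{⟨x−ηe_μ,x⟩})⁻¹φ′(x − ηe_μ) − φ′(x))`, on the same bond `⟨x − ηe_μ, x⟩` as the factors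
`g(x − ηe_μ)A′_μ(x − ηe_μ)` and as the two other (starred) terms; with the forward `D^η_{B̃,μ}` the display fails already for `d = 1`,
`B̃ = 0`, `N = 2` (numerical witness `HOME/lit-balaban-p20/check28.py`).  The theorems are the starred reading; (2.9) is unaffected.

DELIBERATELY NOT HERE: the graphical form (2.9) and the degree bookkeeping (`B3Sect2Statements`); the vertex (1.8) as a term of the expansion
(row B3.Eq1.6-1.11).  Unit `lit-balaban-p20` (literature-prover-lit-balaban-p20-0), 2026-08-21; HOME/FILED.md records the proposals.

v1.1 (same seat, append-only).  §6 (the `+ (3.10)` of the §G.3 line, row **B3.Eq3.10**) = the lattice TAYLOR FORMULA **(3.10)** p. 435 on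
the V1 carriers (`pdiff`/`pdiffAdj`, `runSite`, the staircase corners `mixSite` of `LatticeFieldCalculus.stairSum`, `η = c⁻¹`): `taylor310_run`
(straight contour, the display verbatim), `taylor310_stair` (the staircase `Γ_{x,y}`; the derivative at `x` read along the contour's orientation,
as in the abstract `B3Sect3Statements.taylor310` of r15, p239220, here instantiated on the torus); Sect. 3 has the background gauged away (p. 433),
so (3.10) carries the plain `∂^η`.  §7 = `hU`, `hq` DISCHARGED for the printed `U(A) = exp(qηeA)` of B1 p. 605 (`ChargeData.Urep` of `B1Eq17Urep`, seat p32): `eq28_chargeData`.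
-/

open scoped BigOperators InnerProductSpace

namespace Literature.MathematicalPhysics.QuantumFieldTheory.Balaban1983to89.B3Eq28SummationByParts

open LatticeFieldCalculus

/-! ## 1. Torus bookkeeping (helpers) -/

section Helpers

variable {P : Params} {j : ℕ}

/-- `(x − e_μ) + e_μ = x` on the torus. [folklore] -/
private theorem shift_unshift (x : Site P j) (μ : Fin P.d) : (x.unshift μ).shift μ = x :=
  (shiftEquiv (P := P) (j := j) μ).apply_symm_apply x

/-- Reindexing a site sum by the translation `x ↦ x − e_μ` (a permutation of the finite torus): `Σ_x F(x) = Σ_x F(x − e_μ)`. [folklore] -/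
private theorem sum_comp_unshift {α : Type*} [AddCommMonoid α] (μ : Fin P.d) (F : Site P j → α) :
    ∑ x : Site P j, F (x.unshift μ) = ∑ x : Site P j, F x :=
  Equiv.sum_comp (shiftEquiv (P := P) (j := j) μ).symm F

/-- A sum over the positively oriented bonds is a double sum over initial points and directions. [folklore] -/
private theorem sum_bond_eq {α : Type*} [AddCommMonoid α] (F : PBond P j → α) :
    ∑ b : PBond P j, F b = ∑ x : Site P j, ∑ μ : Fin P.d, F ⟨x, μ⟩ :=
  calc ∑ b : PBond P j, F b = ∑ p : Site P j × Fin P.d, F (bondEquiv p) :=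
        (Equiv.sum_comp (bondEquiv (P := P) (j := j)) F).symm
    _ = ∑ x : Site P j, ∑ μ : Fin P.d, F ⟨x, μ⟩ := Fintype.sum_prod_type _

end Helpers

/-! ## 2. The backward covariant derivative `D^{η*}_{A,μ}` and the covariant divergence `D^{η*}_A` (the adjoint of `D^η_A`) -/

section Operators

variable {P : Params} {j : ℕ} {W : Type*} [NormedAddCommGroup W] [InnerProductSpace ℝ W]

/-- THE BACKWARD COVARIANT DERIVATIVE of a scalar field in the direction `μ`, the `μ`-component of the adjoint `D^{η*}_A` of
p. 425 (2.8) (B1 p. 605: *"−Δ^ε_A = D^{ε*}_A D^ε_A is the covariant Laplace operator"*):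
`(D^{η*}_{A,μ}ψ)(x) = c·(U(−A_{⟨x−e_μ,x⟩}) ψ(x − e_μ) − ψ(x))`, `c = η⁻¹`, `U(−A) = U(A)⁻¹ = U(A)*` — the covariant analogue of
`pdiffAdj` (`∂^{η*}_μ`) and the abelian-scalar analogue of `covDAdj`. [cite: Balaban1983Higgs3, (2.8) p.425] -/
def covDerivScalarAdj (c : ℝ) (Urep : ℝ → W →ₗ[ℝ] W) (A : VecField P j ℝ) (μ : Fin P.d) (ψ : SiteField P j W) :
    SiteField P j W :=
  fun x => c • (Urep (-(A ⟨x.unshift μ, μ⟩)) (ψ (x.unshift μ)) - ψ x)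

/-- THE COVARIANT DIVERGENCE `D^{η*}_A` of a `W`-valued bond function (the operator written `D^{η*}_B̃` in (2.8), acting there on
`b ↦ φ′(b₋)g(b₋)A′_b`): `(D^{η*}_A F)(x) = Σ_μ c·(U(−A_{⟨x−e_μ,x⟩}) F(⟨x − e_μ, x⟩) − F(⟨x, x + e_μ⟩))`; it is the `ℓ²`-adjoint of
`D^η_A = covDerivScalar` (`sum_inner_covDerivScalar`). [cite: Balaban1983Higgs3, (2.8) p.425] -/
def covDivScalar (c : ℝ) (Urep : ℝ → W →ₗ[ℝ] W) (A : VecField P j ℝ) (F : VecField P j W) : SiteField P j W :=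
  fun x => ∑ μ : Fin P.d, c • (Urep (-(A ⟨x.unshift μ, μ⟩)) (F ⟨x.unshift μ, μ⟩) - F ⟨x, μ⟩)

/-- `D^{η*}_A F = Σ_μ D^{η*}_{A,μ} F_μ` componentwise (`F_μ(x) = F(⟨x, x+e_μ⟩)`), as `∂* = Σ_μ ∂*_μ` (`diverg_apply`). [cite: Balaban1983Higgs3, (2.8) p.425] -/
theorem covDivScalar_apply (c : ℝ) (Urep : ℝ → W →ₗ[ℝ] W) (A : VecField P j ℝ) (F : VecField P j W) (x : Site P j) :
    covDivScalar c Urep A F x = ∑ μ : Fin P.d, covDerivScalarAdj c Urep A μ (fun z => F ⟨z, μ⟩) x := rfl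

/-- At `A = 0` and `U(0) = 1` the backward covariant derivative is the backward difference `∂^{η*}_μ` (`pdiffAdj`). [cite: Balaban1983Higgs3, (2.8) p.425] -/
theorem covDerivScalarAdj_zero (c : ℝ) (Urep : ℝ → W →ₗ[ℝ] W) (h0 : Urep 0 = LinearMap.id) (μ : Fin P.d)
    (ψ : SiteField P j W) : covDerivScalarAdj c Urep (fun _ => (0 : ℝ)) μ ψ = pdiffAdj c μ ψ := by
  funext x
  simp [covDerivScalarAdj, pdiffAdj, h0]

/-- At `A = 0` and `U(0) = 1` the covariant divergence is the divergence `∂^{η*}` (`diverg`). [cite: Balaban1983Higgs3, (2.8) p.425] -/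
theorem covDivScalar_zero (c : ℝ) (Urep : ℝ → W →ₗ[ℝ] W) (h0 : Urep 0 = LinearMap.id) (F : VecField P j W) :
    covDivScalar c Urep (fun _ => (0 : ℝ)) F = diverg c F := by
  funext x
  simp [covDivScalar, diverg, h0]

/-- `D^{η*}_A` commutes with every linear map commuting with the `U(−A_b)` (applied below to `q`: `D^{η*}_B̃(qF) = q D^{η*}_B̃ F`,
the step from `[(D^η_B̃φ′)(b)·qφ′(b₋)]` to `φ′(x)·q(D^{η*}_B̃ …)(x)` in (2.8)). [cite: Balaban1983Higgs3, (2.8) p.425] -/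
theorem covDivScalar_comm (c : ℝ) (Urep : ℝ → W →ₗ[ℝ] W) (q : W →ₗ[ℝ] W) (hq : ∀ a v, q (Urep a v) = Urep a (q v))
    (A : VecField P j ℝ) (F : VecField P j W) (x : Site P j) :
    covDivScalar c Urep A (fun b => q (F b)) x = q (covDivScalar c Urep A F x) := by
  simp only [covDivScalar, map_sum, map_smul, map_sub, hq]

end Operators

/-! ## 3. (2.8), first equality: `D^{η*}_B̃` is the `ℓ²`-adjoint of `D^η_B̃` on the torus -/

section Adjoint

variable {P : Params} {j : ℕ} {W : Type*} [NormedAddCommGroup W] [InnerProductSpace ℝ W]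

/-- SUMMATION BY PARTS FOR THE COVARIANT DERIVATIVE (the first equality of (2.8) p. 425, without the spectator factors):
`Σ_b η^d (D^η_Aφ)(b)·F(b) = Σ_x η^d φ(x)·(D^{η*}_A F)(x)` for every `W`-valued bond function `F`, on the torus (no boundary terms),
under `U(a)* = U(−a)` (B1 p. 605). [cite: Balaban1983Higgs3, (2.8) p.425] -/
theorem sum_inner_covDerivScalar (w c : ℝ) (Urep : ℝ → W →ₗ[ℝ] W)
    (hU : ∀ (a : ℝ) (v v' : W), ⟪Urep a v, v'⟫_ℝ = ⟪v, Urep (-a) v'⟫_ℝ)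
    (A : VecField P j ℝ) (φ : SiteField P j W) (F : VecField P j W) :
    ∑ b : PBond P j, w * ⟪covDerivScalar c Urep A φ b, F b⟫_ℝ
      = ∑ x : Site P j, w * ⟪φ x, covDivScalar c Urep A F x⟫_ℝ := by
  rw [sum_bond_eq]
  simp only [covDivScalar, inner_sum, Finset.mul_sum]
  rw [Finset.sum_comm]
  conv_rhs => rw [Finset.sum_comm]
  refine Finset.sum_congr rfl fun μ _ => ?_
  -- direction `μ`: `Σ_x w⟪c(Uφ(x+e_μ) − φ(x)), F_μ(x)⟫ = Σ_x w⟪φ(x), c(U(−A)F_μ(x−e_μ) − F_μ(x))⟫`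
  have hre := sum_comp_unshift (P := P) (j := j) μ
    (fun x => w * (c * ⟪φ (x.shift μ), Urep (-(A ⟨x, μ⟩)) (F ⟨x, μ⟩)⟫_ℝ))
  simp only [shift_unshift] at hre
  calc ∑ x : Site P j, w * ⟪covDerivScalar c Urep A φ ⟨x, μ⟩, F ⟨x, μ⟩⟫_ℝ
      = ∑ x : Site P j, (w * (c * ⟪φ (x.shift μ), Urep (-(A ⟨x, μ⟩)) (F ⟨x, μ⟩)⟫_ℝ) - w * (c * ⟪φ x, F ⟨x, μ⟩⟫_ℝ)) := by
        refine Finset.sum_congr rfl fun x _ => ?_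
        simp only [covDerivScalar, PBond.tgt, real_inner_smul_left, inner_sub_left, hU]
        ring
    _ = ∑ x : Site P j, (w * (c * ⟪φ x, Urep (-(A ⟨x.unshift μ, μ⟩)) (F ⟨x.unshift μ, μ⟩)⟫_ℝ)
          - w * (c * ⟪φ x, F ⟨x, μ⟩⟫_ℝ)) := by
        rw [Finset.sum_sub_distrib, Finset.sum_sub_distrib, ← hre]
    _ = ∑ x : Site P j, w * ⟪φ x, c • (Urep (-(A ⟨x.unshift μ, μ⟩)) (F ⟨x.unshift μ, μ⟩) - F ⟨x, μ⟩)⟫_ℝ := by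
        refine Finset.sum_congr rfl fun x _ => ?_
        rw [real_inner_smul_right, inner_sub_right]
        ring

/-- **(2.8), FIRST EQUALITY** p. 425 [PDF 15], verbatim: *"−e(L^kε) Σ_{b⊂T_η} η^d [(D^η_B̃ φ′)(b)·qφ′(b₋)] g(b₋) A′_b =
−e(L^kε) Σ_{x∈T_η} η^d φ′(x)·q(D^{η*}_B̃ φ′gA′)(x)"* — typed reading: `φ′gA′` is the `W`-valued bond function
`b ↦ g(b₋)A′_b φ′(b₋)` (here with a second leg `ψ′` in the undifferentiated slot; `ψ′ = φ′` is the print), `·` the inner product of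
`W = ℝ^N`, `e(L^kε) = eRun`, `η^d = w`, `η⁻¹ = c`; hypotheses `hU` (B1 p. 605 `U(A)* = U(−A)`) and `hq` (`q` commutes with `U`). [cite: Balaban1983Higgs3, (2.8) p.425] -/
theorem eq28_adjoint (eRun w c : ℝ) (Urep : ℝ → W →ₗ[ℝ] W) (q : W →ₗ[ℝ] W)
    (hU : ∀ (a : ℝ) (v v' : W), ⟪Urep a v, v'⟫_ℝ = ⟪v, Urep (-a) v'⟫_ℝ) (hq : ∀ a v, q (Urep a v) = Urep a (q v))
    (B A : VecField P j ℝ) (g : SiteField P j ℝ) (φ ψ : SiteField P j W) :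
    -eRun * ∑ b : PBond P j, w * (⟪covDerivScalar c Urep B φ b, q (ψ b.src)⟫_ℝ * g b.src * A b)
      = -eRun * ∑ x : Site P j, w * ⟪φ x, q (covDivScalar c Urep B (fun b => (g b.src * A b) • ψ b.src) x)⟫_ℝ := by
  congr 1
  have h := sum_inner_covDerivScalar w c Urep hU B φ (fun b => q ((g b.src * A b) • ψ b.src))
  have hF : ∀ b : PBond P j,
      ⟪covDerivScalar c Urep B φ b, q (ψ b.src)⟫_ℝ * g b.src * A b
        = ⟪covDerivScalar c Urep B φ b, q ((g b.src * A b) • ψ b.src)⟫_ℝ := fun b => by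
    rw [map_smul, real_inner_smul_right]
    ring
  simp only [hF, h, covDivScalar_comm c Urep q hq]

end Adjoint

/-! ## 4. (2.8), second equality: the Leibniz rule for `D^{η*}_B̃` on the product `φ′(b₋) g(b₋) A′_b` -/

section Leibniz

variable {P : Params} {j : ℕ} {W : Type*} [NormedAddCommGroup W] [InnerProductSpace ℝ W]

/-- THE LEIBNIZ RULE behind the second equality of (2.8) p. 425: for the bond function `b ↦ g(b₋)A′_b ψ(b₋)`,
`(D^{η*}_B̃ (ψgA′))(x) = g(x)(∂^{η*}A′)(x) ψ(x) + [Σ_μ (∂^{η*}_μ g)(x) A′_μ(x − e_μ)] ψ(x) + Σ_μ g(x − e_μ)A′_μ(x − e_μ) (D^{η*}_{B̃,μ}ψ)(x)`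
(pointwise; `∂^{η*} = diverg`, `∂^{η*}_μ = pdiffAdj`, `A′_μ(x − e_μ) = A′_{⟨x−e_μ,x⟩}`; no hypothesis on `U` beyond linearity). [cite: Balaban1983Higgs3, (2.8) p.425] -/
theorem covDivScalar_leibniz (c : ℝ) (Urep : ℝ → W →ₗ[ℝ] W) (B A : VecField P j ℝ) (g : SiteField P j ℝ)
    (ψ : SiteField P j W) (x : Site P j) :
    covDivScalar c Urep B (fun b => (g b.src * A b) • ψ b.src) x
      = (g x * diverg c A x) • ψ x
        + (∑ μ : Fin P.d, pdiffAdj c μ g x * A ⟨x.unshift μ, μ⟩) • ψ x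
        + ∑ μ : Fin P.d, (g (x.unshift μ) * A ⟨x.unshift μ, μ⟩) • covDerivScalarAdj c Urep B μ ψ x := by
  simp only [covDivScalar, covDerivScalarAdj, diverg, pdiffAdj, smul_eq_mul, map_smul, Finset.mul_sum, Finset.sum_smul,
    ← Finset.sum_add_distrib]
  refine Finset.sum_congr rfl fun μ _ => ?_
  module

end Leibniz

/-! ## 5. (2.8): the printed chain -/

section Eq28

variable {P : Params} {j : ℕ} {W : Type*} [NormedAddCommGroup W] [InnerProductSpace ℝ W]

/-- **(2.8)** p. 425 [PDF 15] for TWO scalar legs (`φ′` differentiated, `ψ′` in the `q`-slot — the two `φ′`-legs of the vertex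
(2.4) are distinct legs of the graph; the print writes both as `φ′`), verbatim up to that: *"−e(L^kε) Σ_{b⊂T_η} η^d
[(D^η_B̃ φ′)(b)·qψ′(b₋)] g(b₋) A′_b = −e(L^kε) Σ_{x∈T_η} η^d [φ′(x)·qψ′(x)] g(x) (∂^{η*}A′)(x) − e(L^kε) Σ_{x∈T_η} η^d [φ′(x)·qψ′(x)]
Σ_{μ=1}^d (∂^{η*}_μ g)(x) A′_μ(x − ηe_μ) − e(L^kε) Σ_{x∈T_η} η^d Σ_{μ=1}^d [φ′(x)·q(D^{η*}_{B̃,μ}ψ′)(x)] g(x − ηe_μ) A′_μ(x − ηe_μ)"*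
— typed reading: the last term with the BACKWARD `D^{η*}_{B̃,μ}` = `covDerivScalarAdj` (transcript note T-p20-1 in the module
docstring: the page prints `D^η_{B̃,μ}` there); `∂^{η*} = diverg c`, `∂^{η*}_μ = pdiffAdj c μ`, `A′_μ(x − ηe_μ) = A′ ⟨x.unshift μ, μ⟩`,
`e(L^kε) = eRun`, `η^d = w`, `η⁻¹ = c`; hypotheses `hU`, `hq` as in `eq28_adjoint`. [cite: Balaban1983Higgs3, (2.8) p.425] -/
theorem eq28_two (eRun w c : ℝ) (Urep : ℝ → W →ₗ[ℝ] W) (q : W →ₗ[ℝ] W)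
    (hU : ∀ (a : ℝ) (v v' : W), ⟪Urep a v, v'⟫_ℝ = ⟪v, Urep (-a) v'⟫_ℝ) (hq : ∀ a v, q (Urep a v) = Urep a (q v))
    (B A : VecField P j ℝ) (g : SiteField P j ℝ) (φ ψ : SiteField P j W) :
    -eRun * ∑ b : PBond P j, w * (⟪covDerivScalar c Urep B φ b, q (ψ b.src)⟫_ℝ * g b.src * A b)
      = -eRun * ∑ x : Site P j, w * (⟪φ x, q (ψ x)⟫_ℝ * g x * diverg c A x)
        - eRun * ∑ x : Site P j, w * (⟪φ x, q (ψ x)⟫_ℝ * ∑ μ : Fin P.d, pdiffAdj c μ g x * A ⟨x.unshift μ, μ⟩)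
        - eRun * ∑ x : Site P j, w * ∑ μ : Fin P.d,
            ⟪φ x, q (covDerivScalarAdj c Urep B μ ψ x)⟫_ℝ * g (x.unshift μ) * A ⟨x.unshift μ, μ⟩ := by
  rw [eq28_adjoint eRun w c Urep q hU hq B A g φ ψ]
  simp only [covDivScalar_leibniz, map_add, map_smul, map_sum, inner_add_right, real_inner_smul_right, inner_sum]
  rw [show ∀ s t u : ℝ, -eRun * s - eRun * t - eRun * u = -eRun * (s + t + u) by intros; ring,
    ← Finset.sum_add_distrib, ← Finset.sum_add_distrib]
  congr 1
  refine Finset.sum_congr rfl fun x _ => ?_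
  have h3 : ∀ μ : Fin P.d, (g (x.unshift μ) * A ⟨x.unshift μ, μ⟩) * ⟪φ x, q (covDerivScalarAdj c Urep B μ ψ x)⟫_ℝ
      = ⟪φ x, q (covDerivScalarAdj c Urep B μ ψ x)⟫_ℝ * g (x.unshift μ) * A ⟨x.unshift μ, μ⟩ := fun μ => by ring
  simp only [h3]
  ring

/-- **(2.8)** p. 425 [PDF 15], the LITERAL one-field display (`ψ′ = φ′` in `eq28_two`, whose docstring quotes it; typed reading of the last
term and transcript note T-p20-1 as there; for antisymmetric `q` the first two terms vanish, cf. p. 434 "tr q^{2n+1} = 0"). [cite: Balaban1983Higgs3, (2.8) p.425] -/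
theorem eq28 (eRun w c : ℝ) (Urep : ℝ → W →ₗ[ℝ] W) (q : W →ₗ[ℝ] W)
    (hU : ∀ (a : ℝ) (v v' : W), ⟪Urep a v, v'⟫_ℝ = ⟪v, Urep (-a) v'⟫_ℝ) (hq : ∀ a v, q (Urep a v) = Urep a (q v))
    (B A : VecField P j ℝ) (g : SiteField P j ℝ) (φ : SiteField P j W) :
    -eRun * ∑ b : PBond P j, w * (⟪covDerivScalar c Urep B φ b, q (φ b.src)⟫_ℝ * g b.src * A b)
      = -eRun * ∑ x : Site P j, w * (⟪φ x, q (φ x)⟫_ℝ * g x * diverg c A x)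
        - eRun * ∑ x : Site P j, w * (⟪φ x, q (φ x)⟫_ℝ * ∑ μ : Fin P.d, pdiffAdj c μ g x * A ⟨x.unshift μ, μ⟩)
        - eRun * ∑ x : Site P j, w * ∑ μ : Fin P.d,
            ⟪φ x, q (covDerivScalarAdj c Urep B μ φ x)⟫_ℝ * g (x.unshift μ) * A ⟨x.unshift μ, μ⟩ :=
  eq28_two eRun w c Urep q hU hq B A g φ φ

end Eq28

/-! ## 6. (v1.1) The lattice Taylor formula (3.10) p. 435 on the V1 calculus: straight contours and the staircase `Γ_{x,y}` -/

section Taylor310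

variable {P : Params} {j : ℕ} {V : Type*} [AddCommGroup V] [Module ℝ V]

/-- Telescoping along the straight contour `[p, p + m e_μ]`: `f(p + m e_μ) − f(p) = Σ_{t<m} η (∂^η_μ f)(p + t e_μ)`, `η = c⁻¹`. [cite: Balaban1983Higgs3, (3.10) p.435] -/
private theorem run_telescope (c : ℝ) (hc : c ≠ 0) (f : SiteField P j V) (p : Site P j) (μ : Fin P.d) (m : ℕ) :
    f (runSite p μ m) - f p = ∑ t ∈ Finset.range m, c⁻¹ • pdiff c μ f (runSite p μ t) := by
  have h := Finset.sum_range_sub (fun t => f (runSite p μ t)) m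
  rw [runSite_zero] at h; rw [← h]
  exact Finset.sum_congr rfl fun t _ => by rw [runSite_succ, pdiff, smul_smul, inv_mul_cancel₀ hc, one_smul]

/-- The `t`-th site `p − t e_μ` of the straight contour traversed AGAINST the orientation of the lattice bonds. [folklore] -/
private theorem downSite_succ (p : Site P j) (μ : Fin P.d) (t : ℕ) :
    Function.update p μ (p μ - ((t + 1 : ℕ) : ZMod (P.sitesPerDir j)))
      = Site.unshift (Function.update p μ (p μ - (t : ZMod (P.sitesPerDir j)))) μ := by
  simp only [Site.unshift, Function.update_idem, Function.update_self]
  congr 1; push_cast; ring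

/-- Telescoping along `[p, p − m e_μ]` traversed backwards: the reversed bond `−⟨z − e_μ, z⟩` contributes `η(∂^ηf)(−b) = −η(∂^ηf)(b) =
f(z − e_μ) − f(z) = c⁻¹·pdiffAdj c μ f z` (`A_{−b} = −A_b`). [cite: Balaban1983Higgs3, (3.10) p.435] -/
private theorem downrun_telescope (c : ℝ) (hc : c ≠ 0) (f : SiteField P j V) (p : Site P j) (μ : Fin P.d) (m : ℕ) :
    f (Function.update p μ (p μ - (m : ZMod (P.sitesPerDir j)))) - f p
      = ∑ t ∈ Finset.range m, c⁻¹ • pdiffAdj c μ f (Function.update p μ (p μ - (t : ZMod (P.sitesPerDir j)))) := by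
  have h := Finset.sum_range_sub (fun t : ℕ => f (Function.update p μ (p μ - (t : ZMod (P.sitesPerDir j))))) m
  simp only [Nat.cast_zero, sub_zero, Function.update_eq_self] at h; rw [← h]
  exact Finset.sum_congr rfl fun t _ => by rw [downSite_succ, pdiffAdj, smul_smul, inv_mul_cancel₀ hc, one_smul]

/-- Splitting off the value at the initial point: `Σ_{t<m} η a_t = m·η·b + Σ_{t<m} η (a_t − b)`. [folklore] -/
private theorem sum_split_const (c : ℝ) (a : ℕ → V) (b : V) (m : ℕ) :
    ∑ t ∈ Finset.range m, c⁻¹ • a t = ((m : ℕ) : ℝ) • c⁻¹ • b + ∑ t ∈ Finset.range m, c⁻¹ • (a t - b) := by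
  simp only [smul_sub, Finset.sum_sub_distrib, Finset.sum_const, Finset.card_range, ← Nat.cast_smul_eq_nsmul ℝ]
  abel

/-- **(3.10)** p. 435 [PDF 25] along ONE STRAIGHT CONTOUR `Γ_{x,y} = [x, x + mηe_μ]` (all bonds positively oriented, `y_μ − x_μ = mη`,
`y_ν = x_ν` otherwise), verbatim form: *"f(y) = f(x) + Σ_{μ=1}^d (y_μ − x_μ)(∂^η_μ f)(x) + Σ_{b⊂Γ_{x,y}} η|b₋ − x|^α
((∂^ηf)(b) − (∂^ηf)((b)_x))/|b₋ − x|^α, (3.10) where (b)_x denotes a bond b parallel-transported to the point x"* — on the V1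
carriers: `y = runSite x μ m`, `η = c⁻¹`, `∂^η_μ = pdiff c μ`, bonds `b_t = ⟨x + te_μ, x + (t+1)e_μ⟩`, `(b_t)_x = ⟨x, x + e_μ⟩`; the factors
`|b₋ − x|^α/|b₋ − x|^α = 1` only exhibit the Hölder quotient and are not typed (the `t = 0` summand vanishes). [cite: Balaban1983Higgs3, (3.10) p.435] -/
theorem taylor310_run (c : ℝ) (hc : c ≠ 0) (f : SiteField P j V) (x : Site P j) (μ : Fin P.d) (m : ℕ) :
    f (runSite x μ m) = f x + ((m : ℕ) : ℝ) • c⁻¹ • pdiff c μ f x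
      + ∑ t ∈ Finset.range m, c⁻¹ • (pdiff c μ f (runSite x μ t) - pdiff c μ f x) := by
  rw [add_assoc, ← sum_split_const c (fun t => pdiff c μ f (runSite x μ t)) (pdiff c μ f x) m, ← run_telescope c hc f x μ m]
  abel

/-- **(3.10)** p. 435 [PDF 25] along the STAIRCASE `Γ_{x,y}` of the series ([Balaban1984PropagatorsI] (1.7); the contour of
`LatticeFieldCalculus.stairSum · x y`: coordinates changed in the order `d, …, 1`, the run in direction `μ` starting at the corner
`p = mixSite μ x y = (x_1,…,x_μ,y_{μ+1},…,y_d)` with `n_μ = valMinAbs(y_μ − x_μ) ∈ ℤ` signed steps, `y_μ − x_μ = n_μη` on the torus), verbatim: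
*"f(y) = f(x) + Σ_{μ=1}^d (y_μ − x_μ)(∂^η_μ f)(x) + Σ_{b⊂Γ_{x,y}} η|b₋ − x|^α ((∂^ηf)(b) − (∂^ηf)((b)_x))/|b₋ − x|^α, (3.10) where (b)_x denotes
a bond b parallel-transported to the point x."*  Typed reading (the exact identity, as in the abstract `B3Sect3Statements.taylor310`): with
`n⁺ = max(n_μ,0)`, `n⁻ = max(−n_μ,0)`, a POSITIVE run consists of the bonds `b_t = ⟨p + te_μ, p + (t+1)e_μ⟩`, `η(∂^ηf)(b_t) = c⁻¹·pdiff c μ f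
(p + te_μ)`, `(b_t)_x = ⟨x, x+e_μ⟩`, first-order part `n⁺·c⁻¹·pdiff c μ f x = (y_μ − x_μ)(∂^η_μf)(x)` (the print, literally); a NEGATIVE run
consists of the REVERSED bonds `−⟨z − e_μ, z⟩`, `z = p − te_μ`, `η(∂^ηf)(−b) = −η(∂^ηf)(b) = c⁻¹·pdiffAdj c μ f z` (`A_{−b} = −A_b`),
`(−b)_x = −⟨x − e_μ, x⟩`, first-order part `n⁻·c⁻¹·pdiffAdj c μ f x` — the derivative at `x` taken ALONG THE CONTOUR'S ORIENTATION;
Hölder-quotient dressing as in `taylor310_run`. [cite: Balaban1983Higgs3, (3.10) p.435] -/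
theorem taylor310_stair (c : ℝ) (hc : c ≠ 0) (f : SiteField P j V) (x y : Site P j) :
    f y = f x + ∑ μ : Fin P.d, ((((y μ - x μ).valMinAbs.toNat : ℕ) : ℝ) • c⁻¹ • pdiff c μ f x
          + (((-(y μ - x μ).valMinAbs).toNat : ℕ) : ℝ) • c⁻¹ • pdiffAdj c μ f x)
      + ∑ μ : Fin P.d, ((∑ t ∈ Finset.range (y μ - x μ).valMinAbs.toNat,
            c⁻¹ • (pdiff c μ f (runSite (mixSite μ x y) μ t) - pdiff c μ f x))
          + ∑ t ∈ Finset.range (-(y μ - x μ).valMinAbs).toNat,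
            c⁻¹ • (pdiffAdj c μ f (Function.update (mixSite μ x y) μ (x μ - (t : ZMod (P.sitesPerDir j)))) - pdiffAdj c μ f x)) := by
  -- `G i` = the site with coordinates `ν ≥ i` at `y`, `< i` at `x`: `G 0 = y`, `G d = x`, corner of run `μ` = `G (μ+1)`, its end = `G μ`
  set G : ℕ → Site P j := fun i ν => if i ≤ (ν : ℕ) then y ν else x ν
  have hG0 : G 0 = y := by funext ν; simp [G]
  have hGd : G P.d = x := by funext ν; simp [G, not_le.mpr ν.isLt]
  have hcorner : ∀ μ : Fin P.d, mixSite μ x y = G (μ + 1) := fun μ => by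
    funext ν; simp only [mixSite, G, Fin.lt_def]; split_ifs with h1 h2 <;> first | rfl | (exfalso; omega)
  have htel : f y - f x = ∑ μ : Fin P.d, (f (G μ) - f (G (μ + 1))) := by
    rw [Fin.sum_univ_eq_sum_range (fun i => f (G i) - f (G (i + 1))) P.d, Finset.sum_range_sub', hG0, hGd]
  rw [show f y = f x + (f y - f x) from by abel, htel, add_assoc, ← Finset.sum_add_distrib]
  congr 1
  refine Finset.sum_congr rfl fun μ _ => ?_
  rw [hcorner μ] -- direction `μ`: the run from the corner `p = G (μ+1) = mixSite μ x y` to `G μ`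
  set p := G (μ + 1) with hp
  set n : ℤ := (y μ - x μ).valMinAbs with hn
  have hnz : (n : ZMod (P.sitesPerDir j)) = y μ - x μ := by rw [hn]; exact ZMod.coe_valMinAbs _
  have hpμ : p μ = x μ := by simp [hp, G]
  have hend : ∀ v : ZMod (P.sitesPerDir j), v = y μ → Function.update p μ v = G μ := fun v hv => by
    funext ν; by_cases hν : ν = μ
    · subst hν; simp [G, hv]
    · have hne : (ν : ℕ) ≠ μ := fun h => hν (Fin.ext h)
      rw [Function.update_of_ne hν]; simp only [hp, G]; split_ifs with h1 h2 <;> first | rfl | (exfalso; omega)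
  rcases le_or_gt 0 n with h0 | h0
  · -- run in the positive direction: `n⁺ = n`, `n⁻ = 0`
    have hneg : (-n).toNat = 0 := Int.toNat_eq_zero.mpr (by omega)
    have hpos : ((n.toNat : ℕ) : ℤ) = n := Int.toNat_of_nonneg h0
    have hrun : runSite p μ n.toNat = G μ := by
      refine hend _ ?_
      have h2 : ((n.toNat : ℕ) : ZMod (P.sitesPerDir j)) = (n : ZMod (P.sitesPerDir j)) := by
        have h3 := congrArg (Int.cast : ℤ → ZMod (P.sitesPerDir j)) hpos; rwa [Int.cast_natCast] at h3
      rw [hpμ, h2, hnz]; abel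
    simp only [hneg, Finset.sum_range_zero, add_zero, Nat.cast_zero, zero_smul]
    rw [← hrun, run_telescope c hc f p μ, sum_split_const c (fun t => pdiff c μ f (runSite p μ t)) (pdiff c μ f x)]
  · -- run in the negative direction: `n⁺ = 0`, `n⁻ = −n`
    have hpos : n.toNat = 0 := Int.toNat_eq_zero.mpr h0.le
    have hneg : (((-n).toNat : ℕ) : ℤ) = -n := Int.toNat_of_nonneg (by omega)
    have hrun : Function.update p μ (x μ - (((-n).toNat : ℕ) : ZMod (P.sitesPerDir j))) = G μ := by
      refine hend _ ?_
      have h2 : ((((-n).toNat : ℕ) : ℤ) : ZMod (P.sitesPerDir j)) = -(n : ZMod (P.sitesPerDir j)) := by rw [hneg, Int.cast_neg]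
      rw [Int.cast_natCast] at h2; rw [h2, hnz]; abel
    have hdown := downrun_telescope c hc f p μ (-n).toNat; rw [hpμ] at hdown
    simp only [hpos, Finset.sum_range_zero, zero_add, Nat.cast_zero, zero_smul]
    rw [← hrun, hdown,
      sum_split_const c (fun t => pdiffAdj c μ f (Function.update p μ (x μ - (t : ZMod (P.sitesPerDir j))))) (pdiffAdj c μ f x)]

end Taylor310

/-! ## 7. (v1.1) The hypotheses `hU`, `hq` for the printed representation `U(A) = exp(qηeA)` (B1 p. 605; `ChargeData.Urep`) -/

section ChargeRep

open HiggsLattice (ChargeData)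

variable {P : Params} {j : ℕ} {N : ℕ}

/-- B1 p. 605, verbatim: *"Antisymmetry of q implies U(A)* = U(−A) = U(−A)⁻¹"* — as the adjoint relation `⟪U(a)v, v′⟫ = ⟪v, U(−a)v′⟫` on
`ℝ^N` for `ChargeData.Urep` (`B1Eq17Urep`), i.e. the hypothesis `hU` of `eq28`; from `HiggsLattice.ChargeData.star_U`. [cite: Balaban1982Higgs1, (1.7) p.605] -/
theorem chargeU_inner (C : ChargeData N) (η a : ℝ) (v v' : EuclideanSpace ℝ (Fin N)) :
    ⟪C.Urep η a v, v'⟫_ℝ = ⟪v, C.Urep η (-a) v'⟫_ℝ := by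
  rw [ChargeData.Urep_apply, ChargeData.Urep_apply, ← C.star_U η a, ContinuousLinearMap.star_eq_adjoint,
    ContinuousLinearMap.adjoint_inner_right]

/-- `q` commutes with `U(A) = exp(qηeA)` (a power series in `q`): the hypothesis `hq` of `eq28` for `ChargeData.Urep`. [cite: Balaban1982Higgs1, (1.7) p.605] -/
theorem chargeQ_comm_U (C : ChargeData N) (η a : ℝ) (v : EuclideanSpace ℝ (Fin N)) :
    (C.q : EuclideanSpace ℝ (Fin N) →ₗ[ℝ] EuclideanSpace ℝ (Fin N)) (C.Urep η a v)
      = C.Urep η a ((C.q : EuclideanSpace ℝ (Fin N) →ₗ[ℝ] EuclideanSpace ℝ (Fin N)) v) := by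
  have hc : Commute C.q ((η * C.e * a) • C.q) := ContinuousLinearMap.ext fun u => by
    change C.q ((η * C.e * a) • C.q u) = (η * C.e * a) • C.q (C.q u); rw [map_smul]
  have h : Commute C.q (C.U η a) := by unfold ChargeData.U; exact hc.exp_right
  rw [ChargeData.Urep_apply, ChargeData.Urep_apply, ContinuousLinearMap.coe_coe]
  exact congrArg (fun T : EuclideanSpace ℝ (Fin N) →L[ℝ] EuclideanSpace ℝ (Fin N) => T v) h.eq

/-- **(2.8)** p. 425 for the PRINTED coupling of B1 (1.7) p. 605, `U(A) = exp(qηeA)` with `q` antisymmetric, `‖q‖ ≤ 1` (`Urep = ChargeData.Urep`,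
`W = ℝ^N`): the chain `eq28_two` with its two hypotheses discharged (`chargeU_inner`, `chargeQ_comm_U`); typed reading of the last term as
in `eq28_two` (transcript note T-p20-1). [cite: Balaban1983Higgs3, (2.8) p.425] -/
theorem eq28_chargeData (C : ChargeData N) (η eRun w c : ℝ) (B A : VecField P j ℝ) (g : SiteField P j ℝ)
    (φ ψ : SiteField P j (EuclideanSpace ℝ (Fin N))) :
    -eRun * ∑ b : PBond P j, w * (⟪covDerivScalar c (C.Urep η) B φ b, C.q (ψ b.src)⟫_ℝ * g b.src * A b)
      = -eRun * ∑ x : Site P j, w * (⟪φ x, C.q (ψ x)⟫_ℝ * g x * diverg c A x)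
        - eRun * ∑ x : Site P j, w * (⟪φ x, C.q (ψ x)⟫_ℝ * ∑ μ : Fin P.d, pdiffAdj c μ g x * A ⟨x.unshift μ, μ⟩)
        - eRun * ∑ x : Site P j, w * ∑ μ : Fin P.d,
            ⟪φ x, C.q (covDerivScalarAdj c (C.Urep η) B μ ψ x)⟫_ℝ * g (x.unshift μ) * A ⟨x.unshift μ, μ⟩ := by
  simpa only [ContinuousLinearMap.coe_coe] using
    eq28_two eRun w c (C.Urep η) (C.q : _ →ₗ[ℝ] _) (chargeU_inner C η) (chargeQ_comm_U C η) B A g φ ψ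

end ChargeRep

end Literature.MathematicalPhysics.QuantumFieldTheory.Balaban1983to89.B3Eq28SummationByParts
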